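import Mathlib.MeasureTheory.Measure.Haar.DistribChar
import Mathlib.Topology.Algebra.Field
import HarnessLib

/-!
# The module of a locally compact field (Weil, *Basic Number Theory*, Ch. I §2)

Let `F` be a field with a locally compact Hausdorff topology making it a topological division
ring, and assume the topology is not discrete. Following Weil (*Basic Number Theory*, 1967,
Ch. I §2) we define the *module* `mod_F : F → ℝ≥0`: for `a ≠ 0`, `mod_F a` is the factor by which
the homothety `x ↦ a * x` multiplies any Haar measure of the additive group of `F`, and
`mod_F 0 = 0`. We prove Weil's basic results about it:

* `Literature.NumberTheory.GaloisRepresentations.measure_smul_set_eq_modulus_mul`: `μ (a • s) = mod_F a * μ s` (Weil, Ch. I §2, formula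
  before Prop. 1; for `a = 0` this uses non-discreteness);
* `Literature.NumberTheory.GaloisRepresentations.continuous_modulus`: `mod_F` is continuous (Weil, Ch. I §2, Prop. 1);
* `Literature.NumberTheory.GaloisRepresentations.isCompact_setOf_modulus_le`: the balls `B_m = {x | mod_F x ≤ m}` are compact
  (Weil, Ch. I §2, Prop. 2);
* `Literature.NumberTheory.GaloisRepresentations.hasBasis_nhds_zero_modulus`: the sets `{x | mod_F x < ε}`, `ε > 0`, form a basis of
  neighbourhoods of `0` (Weil, Ch. I §2, Cor. 1 of Prop. 2);
* `Literature.NumberTheory.GaloisRepresentations.exists_modulus_add_le_mul_max`: there is `A ≥ 1` with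
  `mod_F (x + y) ≤ A · max (mod_F x) (mod_F y)` (Weil, Ch. I §2, Thm. 4, first assertion).

These are the inputs for Weil's classification of local fields
(`Literature.NumberTheory.GaloisRepresentations.IsLocalField.isNonarchimedean_or_archimedean`).

## Design notes

* `Literature.modulus F : F →*₀ ℝ≥0` is built from Mathlib's `MeasureTheory.distribHaarChar F : Fˣ →* ℝ≥0`
  (the same scaling factor, defined for units) extended by `0 ↦ 0`; it does not depend on a
  choice of Haar measure or of a `MeasurableSpace` structure.
* Hypotheses are unbundled Mathlib classes (`IsTopologicalDivisionRing`, `LocallyCompactSpace`,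
  `T2Space`) plus the explicit hypothesis `¬ DiscreteTopology F` where it is needed, so that the
  file does not depend on the umbrella class `Literature.NumberTheory.GaloisRepresentations.IsLocalField`.
* Weil works with division rings; we only treat (commutative) fields, which is what the
  classification of local fields needs.
-/

open scoped NNReal ENNReal Pointwise Topology
open MeasureTheory Measure Filter Set

namespace Literature.NumberTheory.GaloisRepresentations

section Definition

variable (F : Type*) [Field F] [TopologicalSpace F] [IsTopologicalRing F] [LocallyCompactSpace F]

/-- The *module* `mod_F` of a locally compact topological field `F` (Weil, *Basic Number Theory*,
Ch. I §2): `mod_F a` is the factor by which `x ↦ a * x` multiplies Haar measures of `(F, +)` if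
`a ≠ 0`, and `mod_F 0 = 0`. It is a monoid-with-zero homomorphism `F →*₀ ℝ≥0`.
[cite: WeilBNT1967, Ch. I §2, definition before Prop. 1] -/
noncomputable def modulus : F →*₀ ℝ≥0 where
  toFun a := by classical exact if h : a = 0 then 0 else distribHaarChar F (Units.mk0 a h)
  map_zero' := dif_pos rfl
  map_one' := by
    rw [dif_neg one_ne_zero]
    have : Units.mk0 (1 : F) one_ne_zero = 1 := Units.ext rfl
    rw [this, map_one]
  map_mul' a b := by
    by_cases ha : a = 0
    · simp [ha]
    by_cases hb : b = 0
    · simp [hb]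
    rw [dif_neg (mul_ne_zero ha hb), dif_neg ha, dif_neg hb, Units.mk0_mul, map_mul]

variable {F}

/-- Unfolding lemma: on non-zero elements the module is Mathlib's `distribHaarChar`.
[cite: WeilBNT1967, Ch. I §2, definition before Prop. 1] -/
theorem modulus_apply_of_ne_zero {a : F} (ha : a ≠ 0) :
    modulus F a = distribHaarChar F (Units.mk0 a ha) :=
  dif_neg ha

/-- `mod_F a > 0` for `a ≠ 0`. [cite: WeilBNT1967, Ch. I §2, definition before Prop. 1] -/
theorem modulus_pos {a : F} (ha : a ≠ 0) : 0 < modulus F a := by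
  rw [modulus_apply_of_ne_zero ha]
  exact distribHaarChar_pos

/-- The defining property of the module on non-zero elements: `μ (a • s) = mod_F a * μ s` for
every Haar measure `μ` of `(F, +)` (Weil, *Basic Number Theory*, Ch. I §2, formula (2)).
[cite: WeilBNT1967, Ch. I §2, formula (2)] -/
theorem measure_smul_set_of_ne_zero [MeasurableSpace F] [BorelSpace F] (μ : Measure F)
    [μ.IsAddHaarMeasure] [μ.Regular] {a : F} (ha : a ≠ 0) (s : Set F) :
    μ (a • s) = modulus F a * μ s := by
  rw [modulus_apply_of_ne_zero ha, distribHaarChar_mul μ]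
  rfl

end Definition

section NonDiscrete

/-- In a topological additive group, if `{0}` is a neighbourhood of `0` then the topology is
discrete. [folklore] -/
theorem discreteTopology_of_singleton_zero_mem_nhds {G : Type*} [AddGroup G]
    [TopologicalSpace G] [IsTopologicalAddGroup G] (h : ({0} : Set G) ∈ 𝓝 (0 : G)) :
    DiscreteTopology G :=
  discreteTopology_iff_isOpen_singleton_zero.mpr
    (isOpen_iff_mem_nhds.mpr fun x hx => by rwa [Set.mem_singleton_iff.mp hx])

variable {F : Type*} [Field F] [TopologicalSpace F] [IsTopologicalDivisionRing F]
  [LocallyCompactSpace F] [T2Space F]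

/-- In a non-discrete locally compact field, points have Haar measure zero (so that formula (2)
of Weil, Ch. I §2, also holds for `a = 0` with `mod_F 0 = 0`). [folklore] -/
theorem measure_singleton_zero_eq_zero (hF : ¬ DiscreteTopology F) [MeasurableSpace F]
    [BorelSpace F] (μ : Measure F) [μ.IsAddHaarMeasure] [μ.Regular] : μ {0} = 0 := by
  by_contra h
  apply hF
  have h1 : ({0} : Set F) - {0} ∈ 𝓝 (0 : F) :=
    sub_mem_nhds_zero_of_addHaar_pos_ne_top μ {0} (measurableSet_singleton 0)
      (pos_iff_ne_zero.mpr h) isCompact_singleton.measure_lt_top.ne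
  rw [Set.singleton_sub_singleton, sub_zero] at h1
  exact discreteTopology_of_singleton_zero_mem_nhds h1

/-- `μ (a • s) = mod_F a * μ s` for all `a` (including `a = 0`) in a non-discrete locally compact
field (Weil, *Basic Number Theory*, Ch. I §2, formula (2) and the convention `mod_F 0 = 0`).
[cite: WeilBNT1967, Ch. I §2, formula (2)] -/
theorem measure_smul_set_eq_modulus_mul (hF : ¬ DiscreteTopology F) [MeasurableSpace F]
    [BorelSpace F] (μ : Measure F) [μ.IsAddHaarMeasure] [μ.Regular] (a : F) (s : Set F) :
    μ (a • s) = modulus F a * μ s := by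
  rcases eq_or_ne a 0 with rfl | ha
  · rcases s.eq_empty_or_nonempty with rfl | hs
    · simp
    · rw [Set.zero_smul_set hs, ← Set.singleton_zero, measure_singleton_zero_eq_zero hF μ, map_zero,
        ENNReal.coe_zero, zero_mul]
  · exact measure_smul_set_of_ne_zero μ ha s

/-- Upper semicontinuity of the module (Weil, *Basic Number Theory*, Ch. I §2, proof of
Prop. 1): if `mod_F a < c` then `mod_F w < c` for all `w` near `a`.
[cite: WeilBNT1967, Ch. I §2, Prop. 1] -/
theorem eventually_modulus_lt (hF : ¬ DiscreteTopology F) {a : F} {c : ℝ≥0}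
    (hc : modulus F a < c) : ∀ᶠ w in 𝓝 a, modulus F w < c := by
  borelize F
  set μ : Measure F := Measure.addHaar
  obtain ⟨X, hXc, hX0⟩ := exists_compact_mem_nhds (0 : F)
  have hXpos : μ X ≠ 0 := (measure_pos_of_mem_nhds μ hX0).ne'
  have hXtop : μ X ≠ ∞ := hXc.measure_lt_top.ne
  set δ : ℝ≥0 := c - modulus F a with hδ
  have hδpos : 0 < δ := tsub_pos_of_lt hc
  have hε : ((δ : ℝ≥0∞) * μ X) ≠ 0 := mul_ne_zero (by exact_mod_cast hδpos.ne') hXpos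
  obtain ⟨U, haU, hUo, hμU⟩ :=
    Set.exists_isOpen_lt_add (a • X) ((hXc.smul a).measure_lt_top (μ := μ)).ne hε
  have hev : ∀ᶠ w in 𝓝 a, ∀ x ∈ X, w * x ∈ U := by
    refine hXc.eventually_forall_of_forall_eventually fun x hx => ?_
    have hax : a * x ∈ U := haU (Set.smul_mem_smul_set hx)
    exact (continuous_mul.tendsto (a, x)).eventually_mem (hUo.mem_nhds hax)
  filter_upwards [hev] with w hw
  have hsub : w • X ⊆ U := Set.smul_set_subset_iff.mpr fun x hx => hw x hx
  have key : (modulus F w : ℝ≥0∞) * μ X < ((modulus F a + δ : ℝ≥0) : ℝ≥0∞) * μ X := by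
    calc (modulus F w : ℝ≥0∞) * μ X = μ (w • X) := (measure_smul_set_eq_modulus_mul hF μ w X).symm
      _ ≤ μ U := measure_mono hsub
      _ < μ (a • X) + δ * μ X := hμU
      _ = ((modulus F a + δ : ℝ≥0) : ℝ≥0∞) * μ X := by
        rw [measure_smul_set_eq_modulus_mul hF μ a X, ENNReal.coe_add, add_mul]
  have key' := (ENNReal.mul_lt_mul_iff_left hXpos hXtop).mp key
  have : modulus F w < modulus F a + δ := by exact_mod_cast key'
  rwa [hδ, add_tsub_cancel_of_le hc.le] at this

/-- **Weil, Ch. I §2, Proposition 1**: the module `mod_F` of a non-discrete locally compact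
field is continuous. [cite: WeilBNT1967, Ch. I §2, Prop. 1] -/
theorem continuous_modulus (hF : ¬ DiscreteTopology F) : Continuous (modulus F) := by
  refine continuous_iff_continuousAt.mpr fun a => ?_
  rw [ContinuousAt, tendsto_order]
  refine ⟨fun c hc => ?_, fun c hc => eventually_modulus_lt hF hc⟩
  have ha : a ≠ 0 := by
    rintro rfl
    simp at hc
  rcases eq_or_ne c 0 with rfl | hc0
  · filter_upwards [isOpen_ne.mem_nhds ha] with w hw using modulus_pos hw
  · have hcpos : 0 < c := pos_iff_ne_zero.mpr hc0
    have hinv : modulus F a⁻¹ < c⁻¹ := by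
      rw [map_inv₀]
      exact (inv_lt_inv₀ (modulus_pos ha) hcpos).mpr hc
    have hcont : Tendsto (fun w : F => w⁻¹) (𝓝 a) (𝓝 a⁻¹) := continuousAt_inv₀ ha
    filter_upwards [hcont.eventually (eventually_modulus_lt hF hinv), isOpen_ne.mem_nhds ha]
      with w hw hw0
    rw [map_inv₀] at hw
    exact (inv_lt_inv₀ (modulus_pos hw0) hcpos).mp hw

/-- In a non-discrete locally compact field every neighbourhood of `0` contains non-zero
elements of arbitrarily small module (Weil, Ch. I §2, remark after Prop. 1).
[cite: WeilBNT1967, Ch. I §2, remark after Prop. 1] -/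
theorem exists_ne_zero_modulus_lt (hF : ¬ DiscreteTopology F) {ε : ℝ≥0} (hε : 0 < ε)
    {U : Set F} (hU : U ∈ 𝓝 (0 : F)) : ∃ r ∈ U, r ≠ 0 ∧ modulus F r < ε := by
  by_contra! h
  apply hF
  apply discreteTopology_of_singleton_zero_mem_nhds
  have hlt : {x : F | modulus F x < ε} ∈ 𝓝 (0 : F) :=
    (isOpen_lt (continuous_modulus hF) continuous_const).mem_nhds (by simpa using hε)
  filter_upwards [hU, hlt] with x hxU hxε
  by_contra hx0
  exact absurd (h x hxU hx0) (not_le.mpr hxε)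

/-- If `0 < mod_F r < 1` then `r ^ n → 0`, provided the powers stay in a compact set (the
step in the proof of Weil, Ch. I §2, Prop. 2; the general statement is Cor. 2 of Prop. 2).
[cite: WeilBNT1967, Ch. I §2, proof of Prop. 2] -/
theorem tendsto_pow_of_modulus_lt_one (hF : ¬ DiscreteTopology F) {V : Set F}
    (hVc : IsCompact V) {r : F} (hr1 : modulus F r < 1) (hpow : ∀ n, r ^ (n + 1) ∈ V) :
    Tendsto (fun n : ℕ => r ^ n) atTop (𝓝 0) := by
  apply hVc.tendsto_nhds_of_unique_mapClusterPt
  · exact eventually_atTop.mpr ⟨1, fun n hn => by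
      obtain ⟨k, rfl⟩ : ∃ k, n = k + 1 := ⟨n - 1, by omega⟩
      exact hpow k⟩
  · intro x _ hx
    by_contra hx0
    have hpos : 0 < modulus F x := modulus_pos hx0
    have hnhds : {y : F | modulus F x / 2 < modulus F y} ∈ 𝓝 x :=
      (isOpen_lt continuous_const (continuous_modulus hF)).mem_nhds
        (by simpa using NNReal.half_lt_self hpos.ne')
    have hfreq := (mapClusterPt_iff_frequently.mp hx) _ hnhds
    have hlim : Tendsto (fun n : ℕ => modulus F (r ^ n)) atTop (𝓝 0) := by
      simpa only [map_pow] using tendsto_pow_atTop_nhds_zero_of_lt_one zero_le hr1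
    have hev : ∀ᶠ n : ℕ in atTop, modulus F (r ^ n) < modulus F x / 2 :=
      (tendsto_order.mp hlim).2 _ (by positivity)
    obtain ⟨n, hn1, hn2⟩ := (hfreq.and_eventually hev).exists
    exact absurd (hn1.trans hn2) (lt_irrefl _)

/-- **Weil, Ch. I §2, Proposition 2**: in a non-discrete locally compact field the balls
`B_m = {x | mod_F x ≤ m}` of the module are compact. [cite: WeilBNT1967, Ch. I §2, Prop. 2] -/
theorem isCompact_setOf_modulus_le (hF : ¬ DiscreteTopology F) (m : ℝ≥0) :
    IsCompact {x : F | modulus F x ≤ m} := by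
  classical
  obtain ⟨V, hVc, hV0⟩ := exists_compact_mem_nhds (0 : F)
  -- a neighbourhood `W` of `0` with `W * V ⊆ V`
  have hW : ∀ᶠ w in 𝓝 (0 : F), ∀ v ∈ V, w * v ∈ V := by
    refine hVc.eventually_forall_of_forall_eventually fun v _ => ?_
    have h := continuous_mul.tendsto ((0 : F), v)
    rw [zero_mul] at h
    exact h.eventually_mem hV0
  -- an element `r ∈ V ∩ W` with `0 < mod_F r < 1`
  obtain ⟨r, ⟨hrV, hrW⟩, hr0, hr1⟩ := exists_ne_zero_modulus_lt hF one_pos (inter_mem hV0 hW)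
  have hpow : ∀ n, r ^ (n + 1) ∈ V := by
    intro n
    induction n with
    | zero => simpa using hrV
    | succ n ih => rw [pow_succ']; exact hrW _ ih
  have htend : Tendsto (fun n : ℕ => r ^ n) atTop (𝓝 0) :=
    tendsto_pow_of_modulus_lt_one hF hVc hr1 hpow
  -- the compact set `X = closure (V \\ r • V)` avoids `0`
  set X : Set F := closure (V \ r • V) with hXdef
  have hXc : IsCompact X := hVc.closure_of_subset sdiff_subset
  have h0X : (0 : F) ∉ X := by
    intro h0
    have hsub : X ⊆ (interior (r • V))ᶜ := by
      rw [hXdef, ← closure_compl]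
      exact closure_mono (Set.sdiff_subset_compl _ _)
    exact hsub h0 (mem_interior_iff_mem_nhds.mpr ((set_smul_mem_nhds_zero_iff hr0).mpr hV0))
  obtain ⟨μ0, hμ0pos, hμ0⟩ : ∃ μ0 : ℝ≥0, 0 < μ0 ∧ ∀ x ∈ X, μ0 ≤ modulus F x := by
    rcases X.eq_empty_or_nonempty with hXe | hXne
    · exact ⟨1, one_pos, by simp [hXe]⟩
    · obtain ⟨x0, hx0X, hmin⟩ := hXc.exists_isMinOn hXne (continuous_modulus hF).continuousOn
      exact ⟨modulus F x0, modulus_pos (fun h => h0X (h ▸ hx0X)), fun x hx => hmin hx⟩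
  -- choose `N` with `mod_F r ^ N * m < μ0`
  obtain ⟨N, hN⟩ : ∃ N : ℕ, modulus F r ^ N * m < μ0 := by
    have hm1 : (0 : ℝ≥0) < m + 1 := by positivity
    obtain ⟨N, hN⟩ := exists_pow_lt_of_lt_one (div_pos hμ0pos hm1) hr1
    refine ⟨N, ?_⟩
    rw [lt_div_iff₀ hm1] at hN
    calc modulus F r ^ N * m ≤ modulus F r ^ N * (m + 1) := by gcongr; exact le_add_of_nonneg_right zero_le_one
      _ < μ0 := hN
  -- the covering `B_m ⊆ V ∪ ⋃_{n < N} (r⁻¹) ^ n • V`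
  have hcover : {x : F | modulus F x ≤ m} ⊆ V ∪ ⋃ n ∈ Finset.range N, (r⁻¹ ^ n) • V := by
    intro a ha
    by_cases haV : a ∈ V
    · exact Or.inl haV
    right
    have hex : ∃ n : ℕ, r ^ n * a ∈ V := by
      have : Tendsto (fun n : ℕ => r ^ n * a) atTop (𝓝 0) := by
        simpa using htend.mul_const a
      exact (this.eventually_mem hV0).exists
    set ν := Nat.find hex with hνdef
    have hν : r ^ ν * a ∈ V := Nat.find_spec hex
    have hν0 : 0 < ν := by
      rw [hνdef]
      exact (Nat.find_pos hex).mpr (by simpa using haV)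
    have hνmin : r ^ (ν - 1) * a ∉ V := Nat.find_min hex (Nat.sub_lt hν0 one_pos)
    have hmem : r ^ ν * a ∈ V \ r • V := by
      refine ⟨hν, fun h => hνmin ?_⟩
      obtain ⟨v, hv, hveq⟩ := Set.mem_smul_set.mp h
      have hv' : v = r ^ (ν - 1) * a := by
        apply mul_left_cancel₀ hr0
        calc r * v = r ^ ν * a := hveq
          _ = r * (r ^ (ν - 1) * a) := by
            rw [← mul_assoc, ← pow_succ', Nat.sub_add_cancel hν0]
      rwa [← hv']
    have h1 := hμ0 _ (subset_closure hmem)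
    rw [map_mul, map_pow] at h1
    have hνN : ν < N := by
      by_contra! hle
      have : modulus F r ^ ν * modulus F a ≤ modulus F r ^ N * m :=
        mul_le_mul (pow_le_pow_right_of_le_one' hr1.le hle) ha zero_le zero_le
      exact absurd (h1.trans this) (not_le.mpr hN)
    refine Set.mem_iUnion₂.mpr ⟨ν, Finset.mem_range.mpr hνN, r ^ ν * a, hν, ?_⟩
    simp only [smul_eq_mul, inv_pow, ← mul_assoc, inv_mul_cancel₀ (pow_ne_zero ν hr0), one_mul]
  have hKc : IsCompact (V ∪ ⋃ n ∈ Finset.range N, (r⁻¹ ^ n) • V) :=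
    hVc.union ((Finset.range N).isCompact_biUnion fun n _ => hVc.smul _)
  exact hKc.of_isClosed_subset (isClosed_le (continuous_modulus hF) continuous_const) hcover

/-- **Weil, Ch. I §2, Corollary 1 of Proposition 2**: the sets `{x | mod_F x < ε}` (`ε > 0`)
form a basis of neighbourhoods of `0`. [cite: WeilBNT1967, Ch. I §2, Cor. 1 of Prop. 2] -/
theorem hasBasis_nhds_zero_modulus (hF : ¬ DiscreteTopology F) :
    (𝓝 (0 : F)).HasBasis (fun ε : ℝ≥0 => 0 < ε) (fun ε => {x : F | modulus F x < ε}) := by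
  refine ⟨fun U => ⟨fun hU => ?_, fun ⟨ε, hε, hsub⟩ => mem_of_superset
    ((isOpen_lt (continuous_modulus hF) continuous_const).mem_nhds (by simpa using hε)) hsub⟩⟩
  set V : ℕ → Set F := fun n => {x : F | modulus F x ≤ ((n : ℝ≥0) + 1)⁻¹} with hVdef
  have hVdir : Directed (· ⊇ ·) V := by
    refine directed_of_isDirected_le fun i j hij x hx => ?_
    simp only [hVdef, Set.mem_setOf_eq] at hx ⊢
    exact hx.trans (by gcongr)
  obtain ⟨n, hn⟩ := exists_subset_nhds_of_isCompact' hVdir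
    (fun n => isCompact_setOf_modulus_le hF _)
    (fun n => isClosed_le (continuous_modulus hF) continuous_const) (U := U) (by
      intro x hx
      have hx0 : x = 0 := by
        by_contra hx0
        obtain ⟨k, hk⟩ := exists_nat_gt (modulus F x)⁻¹
        have hxk : modulus F x ≤ ((k : ℝ≥0) + 1)⁻¹ := Set.mem_iInter.mp hx k
        have : (modulus F x)⁻¹ < (k : ℝ≥0) + 1 := hk.trans (lt_add_one _)
        rw [inv_lt_comm₀ (modulus_pos hx0) (by positivity)] at this
        exact absurd (hxk.trans_lt this) (lt_irrefl _)
      subst hx0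
      exact hU)
  exact ⟨((n : ℝ≥0) + 1)⁻¹, by positivity, fun x hx => hn (show modulus F x ≤ _ from le_of_lt hx)⟩

/-- **Weil, Ch. I §2, Theorem 4** (first assertion): there is a constant `A ≥ 1` with
`mod_F (x + y) ≤ A · max (mod_F x) (mod_F y)` for all `x, y`.
[cite: WeilBNT1967, Ch. I §2, Thm. 4] -/
theorem exists_modulus_add_le_mul_max (hF : ¬ DiscreteTopology F) :
    ∃ A : ℝ≥0, 1 ≤ A ∧ ∀ x y : F, modulus F (x + y) ≤ A * max (modulus F x) (modulus F y) := by
  obtain ⟨A, hA⟩ : ∃ A : ℝ≥0, ∀ x : F, modulus F x ≤ 1 → modulus F (1 + x) ≤ A := by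
    have hc : IsCompact {x : F | modulus F x ≤ 1} := isCompact_setOf_modulus_le hF 1
    obtain ⟨A, hA⟩ := hc.bddAbove_image (f := fun x => modulus F (1 + x))
      ((continuous_modulus hF).comp (continuous_const.add continuous_id)).continuousOn
    exact ⟨A, fun x hx => hA ⟨x, hx, rfl⟩⟩
  refine ⟨max A 1, le_max_right _ _, fun x y => ?_⟩
  wlog hxy : modulus F y ≤ modulus F x generalizing x y
  · rw [add_comm, max_comm (modulus F x)]
    exact this y x (le_of_not_ge hxy)
  rcases eq_or_ne x 0 with rfl | hx
  · have hy : y = 0 := by simpa using hxy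
    simp [hy]
  · have hxy' : x + y = x * (1 + x⁻¹ * y) := by
      rw [mul_add, mul_one, ← mul_assoc, mul_inv_cancel₀ hx, one_mul]
    have h1 : modulus F (x⁻¹ * y) ≤ 1 := by
      rw [map_mul, map_inv₀]
      exact (inv_mul_le_one₀ (modulus_pos hx)).mpr hxy
    rw [hxy', map_mul, max_eq_left hxy]
    calc modulus F x * modulus F (1 + x⁻¹ * y) ≤ modulus F x * A := by gcongr; exact hA _ h1
      _ ≤ max A 1 * modulus F x := by rw [mul_comm]; gcongr; exact le_max_left _ _

end NonDiscrete

end Literature.NumberTheory.GaloisRepresentations
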